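import Mathlib.Data.Real.Basic
import Mathlib.Tactic
import HarnessLib

/-!
# QUANT lane R8, T-DEC, leg (III), blob case — cell B-TWIN of `LawDec.GatedSliceMixLaw'`: the real-algebra core behind
# `mixLawCellBTwin_holds` (rate lemma, the blob-mean bound, the core inequality at the virtual height `S/y`, the monotonicity constant)

builds on p205010 (kernel theorem, internal audit signed; external expert review pending)

Support file (`--supports stmt-CriticalPhenomena-4575`), QUANT lane seat prim-quant-arm-3 (gen 120), rung R8 of
`run/shared/lean/prim/quant/LADDER.md`; lead g33's ask (lane INBOX l.1163: "(PI) for BTwin").  Pure real inequalities (no lane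
definitions), standard axioms, no sorries.  Consumed by `…QuantGatedSliceMixLawBTwinHolds`.

THE ARGUMENT (frame of cell B-TWIN: `S = (1−z)(k₁ + (k₂−k₁)λ)`, `t = S + ag(1−z)`, `p = t − 2k₁`, `u = y/(1−y)`, overflow of the twin
`o = (1−z)(1−λ)·ω` with `ω = 1 − g` (twin incompatible) or `ω = 1 − ag/p` (twin saturated), so `0 ≤ ω ≤ 1 − g`):
* `btwin_rate_pool` — a rate `r` with `r·ω·S·(1−y) ≤ y(S − k₁)` ships `o` plus the zeros within the giant budget: `r·o + u z ≤ (1−z)λ`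
  (uses `y·k₂ ≤ S`, `k₁ ≤ S`; slack `(S − (1−z)k₁)(S − y k₂)`).  With `r = u` this is the `θ = 0` routing whenever `ωS ≤ S − k₁`.
* `btwin_delta_of_incomp` / `btwin_delta_of_sat` — if `ωS > S − k₁` then the blob mean is below the low: `ag(1−z) < k₁`, i.e.
  `p < S − k₁` (so `k₁` is compatible with every mid `h > S`, and LIGHT at the virtual height `S/y`).
* `btwin_core_light` — the rate condition of `btwin_rate_pool` for the light usage at the virtual height `S/y`
  (`N = S − y k₁`): `(yN + (1−y)p)·ω·S ≤ (S − k₁)((1+y)N − y p)` whenever `p ≤ S − k₁`, `2k₁ ≤ S`, `y ≤ g`, `ω ≤ 1 − g`.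
* `btwin_B_nonneg` — when the `θ = 0` routing fails, the constant `B = o(u(S−k₁) + Sg) − S(1−g)((1−z)λ − uz)` is `≥ 0`, which makes
  `pairGate(k₁,h)·(o·u·(h−k₁) − B)` nondecreasing in `h`, so the actual mid `h ≤ S/y` is no worse than the virtual one.
HONEST STATUS: support lemmas; RATE class log* / honest sentence unchanged.

[this work].  Nothing here is cited as a published result.  The gluing rows served [cite: KozmaNitzan2024, Conjecture 3 (p. 15)];
product measure [cite: Grimmett1999, §1.3 p. 10].
-/

namespace Summit.CriticalPhenomena.PercolationContinuityZ3.Theorems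

namespace Quant

namespace LawDec

/-- **RATE LEMMA.**  On the frame of cell B-TWIN (`S = (1−z)(k₁ + (k₂−k₁)λ)`, `k₁ ≤ S`, `y·k₂ ≤ S`, `y + z ≤ 1`): if a rate
`r ≥ 0` satisfies `r·ω·S·(1−y) ≤ y·(S − k₁)` then shipping the overflow `o = (1−z)(1−λ)·ω` at rate `r` and the zeros at the giant
rate `u = y/(1−y)` fits the giant budget: `r·o + u·z ≤ (1−z)λ`.  Slack `(S − (1−z)k₁)(S − y k₂)·y/(S(k₂−k₁)(1−y))`. [this work] -/
theorem btwin_rate_pool (y z S lam k₁ k₂ r ω : ℝ) (hy0 : 0 < y) (hy1 : y < 1) (hz0 : 0 ≤ z) (hyz : y + z ≤ 1)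
    (hk0 : 0 ≤ k₁) (hk : k₁ < k₂) (hSk₁ : k₁ ≤ S) (hS0 : 0 < S) (hyk₂ : y * k₂ ≤ S) (hlam1 : lam ≤ 1)
    (hmean : (1 - z) * (k₁ + (k₂ - k₁) * lam) = S)
    (hrate : r * ω * S * (1 - y) ≤ y * (S - k₁)) :
    r * ((1 - z) * (1 - lam) * ω) + y / (1 - y) * z ≤ (1 - z) * lam := by
  have h1y : 0 < 1 - y := by linarith
  have hK : 0 < k₂ - k₁ := by linarith
  have eA : (1 - z) * lam * (k₂ - k₁) = S - (1 - z) * k₁ := by linear_combination hmean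
  have eB : (1 - z) * (1 - lam) * (k₂ - k₁) = (1 - z) * k₂ - S := by linear_combination -hmean
  have hck₂S : 0 ≤ (1 - z) * k₂ - S := by
    rw [← eB]; exact mul_nonneg (mul_nonneg (by linarith) (by linarith)) hK.le
  have h1 : r * ω * (1 - y) * ((1 - z) * k₂ - S) * S ≤ y * (S - k₁) * ((1 - z) * k₂ - S) := by
    nlinarith [mul_le_mul_of_nonneg_right hrate hck₂S]
  have hid : (1 - y) * S * (S - (1 - z) * k₁) - y * (S - k₁) * ((1 - z) * k₂ - S) - y * z * S * (k₂ - k₁)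
      = (S - (1 - z) * k₁) * (S - y * k₂) := by ring
  have hpos : 0 ≤ (S - (1 - z) * k₁) * (S - y * k₂) := mul_nonneg (by nlinarith) (by linarith)
  -- rewrite the goal over the common denominator (1−y)(k₂−k₁)
  have eL : r * ((1 - z) * (1 - lam) * ω) = r * ω * ((1 - z) * k₂ - S) / (k₂ - k₁) := by
    rw [eq_div_iff hK.ne']; linear_combination r * ω * eB
  have eR : (1 - z) * lam = (S - (1 - z) * k₁) / (k₂ - k₁) := by
    rw [eq_div_iff hK.ne']; linear_combination eA
  rw [eL, eR, div_mul_eq_mul_div, div_add_div _ _ hK.ne' h1y.ne', div_le_div_iff₀ (mul_pos hK h1y) hK]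
  have key : (r * ω * ((1 - z) * k₂ - S) * (1 - y) + y * z * (k₂ - k₁)) * S ≤ (S - (1 - z) * k₁) * (1 - y) * S := by
    nlinarith [h1, hid, hpos]
  have key2 : r * ω * ((1 - z) * k₂ - S) * (1 - y) + y * z * (k₂ - k₁) ≤ (S - (1 - z) * k₁) * (1 - y) :=
    le_of_mul_le_mul_right key hS0
  nlinarith [key2, hK]

/-- **INCOMPATIBLE TWIN: the blob mean is below `k₁` when the θ=0 routing fails.**  With `t = S + ag(1−z) ≥ 2k₁ + a`
(i.e. `a(1 − g(1−z)) ≤ S − 2k₁`) and `g·S < k₁` (the failure of `(1−g)S ≤ S − k₁`): `a·g·(1−z) < k₁`. [this work] -/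
theorem btwin_delta_of_incomp (z g S a k₁ : ℝ) (hz0 : 0 ≤ z) (hz1 : z < 1) (hg0 : 0 ≤ g) (hg1 : g < 1) (hS0 : 0 ≤ S)
    (hinc : a * (1 - g * (1 - z)) ≤ S - 2 * k₁) (hfail : g * S < k₁) :
    a * g * (1 - z) < k₁ := by
  have hgc1 : 0 < 1 - g * (1 - z) := by nlinarith
  -- a·g(1−z)·(1 − g(1−z)) ≤ g(1−z)(S − 2k₁) < k₁(1 − g(1−z))
  have h1 : a * g * (1 - z) * (1 - g * (1 - z)) ≤ g * (1 - z) * (S - 2 * k₁) := by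
    nlinarith [mul_le_mul_of_nonneg_left hinc (mul_nonneg hg0 (by linarith : (0:ℝ) ≤ 1 - z))]
  have hk0 : 0 ≤ k₁ := by nlinarith [mul_nonneg hg0 hS0]
  have h2 : g * (1 - z) * (S - 2 * k₁) < k₁ * (1 - g * (1 - z)) := by
    have e : k₁ * (1 - g * (1 - z)) - g * (1 - z) * (S - 2 * k₁) = (k₁ - g * S) + g * z * S + g * (1 - z) * k₁ := by ring
    have : 0 < (k₁ - g * S) + g * z * S + g * (1 - z) * k₁ := by
      have t1 : 0 ≤ g * z * S := mul_nonneg (mul_nonneg hg0 hz0) hS0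
      have t2 : 0 ≤ g * (1 - z) * k₁ := mul_nonneg (mul_nonneg hg0 (by linarith)) hk0
      linarith
    linarith [e]
  by_contra hcon
  have : k₁ * (1 - g * (1 - z)) ≤ a * g * (1 - z) * (1 - g * (1 - z)) :=
    mul_le_mul_of_nonneg_right (not_lt.1 hcon) hgc1.le
  linarith

/-- **SATURATED TWIN: the blob mean is below `k₁` when the θ=0 routing fails.**  With `p = S − 2k₁ + ag(1−z)` and
`a·g·S < k₁·p` (the failure of `(p − ag)S ≤ p(S − k₁)`): `a·g·(1−z) < k₁`. [this work] -/
theorem btwin_delta_of_sat (z g S a k₁ : ℝ) (hz0 : 0 ≤ z) (hz1 : z < 1) (hS0 : 0 < S)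
    (hk0 : 0 ≤ k₁) (hSk : 2 * k₁ ≤ S) (hfail : a * g * S < k₁ * (S - 2 * k₁ + a * g * (1 - z))) :
    a * g * (1 - z) < k₁ := by
  -- agc(S − ck₁) < ck₁(S − 2k₁) ≤ k₁(S − ck₁)
  have hc0 : 0 < 1 - z := by linarith
  have h1 : a * g * (1 - z) * (S - (1 - z) * k₁) < (1 - z) * k₁ * (S - 2 * k₁) := by
    nlinarith [mul_lt_mul_of_pos_left hfail hc0]
  have h2 : (1 - z) * k₁ * (S - 2 * k₁) ≤ k₁ * (S - (1 - z) * k₁) := by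
    have e : k₁ * (S - (1 - z) * k₁) - (1 - z) * k₁ * (S - 2 * k₁) = k₁ * z * S + (1 - z) * k₁ * k₁ := by ring
    have t1 : 0 ≤ k₁ * z * S := mul_nonneg (mul_nonneg hk0 hz0) hS0.le
    have t2 : 0 ≤ (1 - z) * k₁ * k₁ := mul_nonneg (mul_nonneg hc0.le hk0) hk0
    linarith [e]
  have hpos : 0 < S - (1 - z) * k₁ := by nlinarith [mul_nonneg hz0 hk0]
  by_contra hcon
  have : k₁ * (S - (1 - z) * k₁) ≤ a * g * (1 - z) * (S - (1 - z) * k₁) :=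
    mul_le_mul_of_nonneg_right (not_lt.1 hcon) hpos.le
  linarith

/-- **THE CORE INEQUALITY** (virtual mid at height `S/y`, light closed form): with `N = S − y k₁`, `p ≤ S − k₁`, `2k₁ ≤ S`,
`0 < y ≤ g ≤ 1`, `0 ≤ ω ≤ 1 − g`, `0 ≤ k₁`:  `(yN + (1−y)p)·ω·S ≤ (S − k₁)·((1+y)N − y p)`.  At `ω = 1−g`, `p = S − k₁ − δ` the
difference is `gS(S−k₁) − y²k₁(S−k₁) − (1−g)(1−y)S y k₁ + δ((S−k₁)y + (1−g)(1−y)S) ≥ 0`. [this work] -/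
theorem btwin_core_light (y g S p k₁ ω : ℝ) (hy0 : 0 < y) (hy1 : y < 1) (hyg : y ≤ g) (hg1 : g ≤ 1) (hk0 : 0 ≤ k₁)
    (hSk : 2 * k₁ ≤ S) (hp0 : 0 ≤ p) (hpS : p ≤ S - k₁) (hω1 : ω ≤ 1 - g) :
    (y * (S - y * k₁) + (1 - y) * p) * ω * S ≤ (S - k₁) * ((1 + y) * (S - y * k₁) - y * p) := by
  have hS0 : 0 ≤ S := by linarith
  have hSk₁ : k₁ ≤ S - k₁ := by linarith
  have hg0 : 0 ≤ g := le_trans hy0.le hyg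
  have h1y : 0 ≤ 1 - y := by linarith
  have hyk : y * k₁ ≤ k₁ := by nlinarith
  have hN : 0 ≤ S - y * k₁ := by linarith
  have hN0 : 0 ≤ y * (S - y * k₁) + (1 - y) * p := add_nonneg (mul_nonneg hy0.le hN) (mul_nonneg h1y hp0)
  -- reduce to ω = 1 − g
  have hmono : (y * (S - y * k₁) + (1 - y) * p) * ω * S ≤ (y * (S - y * k₁) + (1 - y) * p) * (1 - g) * S := by
    have := mul_le_mul_of_nonneg_left hω1 hN0
    nlinarith [mul_le_mul_of_nonneg_right this hS0]
  refine le_trans hmono ?_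
  -- with δ = S − k₁ − p ≥ 0
  have hid : (S - k₁) * ((1 + y) * (S - y * k₁) - y * p) - (y * (S - y * k₁) + (1 - y) * p) * (1 - g) * S
      = g * S * (S - k₁) - y ^ 2 * k₁ * (S - k₁) - (1 - g) * (1 - y) * S * y * k₁
        + (S - k₁ - p) * ((S - k₁) * y + (1 - g) * (1 - y) * S) := by ring
  have hin : 0 ≤ (S - k₁) * y + (1 - g) * (1 - y) * S :=
    add_nonneg (mul_nonneg (by linarith) hy0.le) (mul_nonneg (mul_nonneg (by linarith) h1y) hS0)
  have hδ : 0 ≤ (S - k₁ - p) * ((S - k₁) * y + (1 - g) * (1 - y) * S) := mul_nonneg (by linarith) hin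
  -- gS(S−k₁) ≥ yS(S−k₁) ≥ y k₁ S ≥ y k₁ (y(S−k₁) + (1−g)(1−y)S)
  have h1 : y * S * (S - k₁) ≤ g * S * (S - k₁) := by nlinarith [mul_nonneg (sub_nonneg.2 hyg) (mul_nonneg hS0 (by linarith : (0:ℝ) ≤ S - k₁))]
  have h2 : y * (S - k₁) + (1 - g) * (1 - y) * S ≤ S := by
    have e : S - (y * (S - k₁) + (1 - g) * (1 - y) * S) = y * k₁ + g * (1 - y) * S := by ring
    have t1 : 0 ≤ y * k₁ := mul_nonneg hy0.le hk0
    have t2 : 0 ≤ g * (1 - y) * S := mul_nonneg (mul_nonneg hg0 h1y) hS0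
    linarith [e]
  have h3 : y ^ 2 * k₁ * (S - k₁) + (1 - g) * (1 - y) * S * y * k₁ = y * k₁ * (y * (S - k₁) + (1 - g) * (1 - y) * S) := by ring
  have h4 : y * k₁ * (y * (S - k₁) + (1 - g) * (1 - y) * S) ≤ y * k₁ * S :=
    mul_le_mul_of_nonneg_left h2 (mul_nonneg hy0.le hk0)
  have h5 : y * k₁ * S ≤ y * S * (S - k₁) := by nlinarith [mul_le_mul_of_nonneg_left hSk₁ (mul_nonneg hy0.le hS0)]
  nlinarith [hid, hδ, h1, h3, h4, h5]

/-- **the monotonicity constant is nonnegative when the θ=0 routing fails**: `(1−z)λ < u(z + o)`, `y ≤ g`, `k₁ ≤ S`, `o ≥ 0`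
⟹ `0 ≤ o·(u(S−k₁) + S g) − S(1−g)((1−z)λ − u z)` (`u = y/(1−y)`). [this work] -/
theorem btwin_B_nonneg (y z g S lam k₁ o : ℝ) (hy0 : 0 < y) (hy1 : y < 1) (hyg : y ≤ g) (hg1 : g ≤ 1) (hSk₁ : k₁ ≤ S)
    (hk0 : 0 ≤ k₁) (ho : 0 ≤ o) (hfail : (1 - z) * lam < y / (1 - y) * (z + o)) :
    0 ≤ o * (y / (1 - y) * (S - k₁) + S * g) - S * (1 - g) * ((1 - z) * lam - y / (1 - y) * z) := by
  have h1y : 0 < 1 - y := by linarith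
  set u := y / (1 - y) with hu
  have hu0 : 0 < u := div_pos hy0 h1y
  have hS0 : 0 ≤ S := le_trans hk0 hSk₁
  -- replace (1−z)λ by its upper bound u(z+o)
  have h1 : S * (1 - g) * ((1 - z) * lam - u * z) ≤ S * (1 - g) * (u * o) := by
    apply mul_le_mul_of_nonneg_left _ (mul_nonneg hS0 (by linarith)); linarith
  -- o(u(S−k₁) + Sg) − S(1−g)u o = o (S g (1+u) − u k₁) = o (S g − y k₁)/(1−y) ≥ 0
  have h2 : 0 ≤ o * (u * (S - k₁) + S * g) - S * (1 - g) * (u * o) := by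
    have e : o * (u * (S - k₁) + S * g) - S * (1 - g) * (u * o) = o * (S * g * (1 + u) - u * k₁) := by ring
    rw [e]
    refine mul_nonneg ho ?_
    have hu1 : 1 + u = 1 / (1 - y) := by rw [hu]; field_simp; ring
    rw [hu1, hu]
    have : S * g * (1 / (1 - y)) - y / (1 - y) * k₁ = (S * g - y * k₁) / (1 - y) := by field_simp
    rw [this]
    exact div_nonneg (by nlinarith [mul_le_mul_of_nonneg_left hyg hS0]) h1y.le
  linarith

end LawDec

end Quant

end Summit.CriticalPhenomena.PercolationContinuityZ3.Theorems
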